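import Literature.Analysis.FluidPDE.NSBoundedSpatialHolder
import Literature.Analysis.FluidPDE.WholeSpaceIBP
import HarnessLib

/-!
# Localisation of a weak solution of `Δw = div F` by a cut-off

Analysis/FluidPDE support file (everything proved) on the discharge path of the named fact
`Literature.Analysis.FluidPDE.LaplaceDivFormInteriorHolder` (`NSBoundedSpatialHolder.lean`;
Gilbarg–Trudinger 2001, Thm. 8.24 for the Laplacian). In the weak formulation of that fact —
`w` with weak derivative `g` on the ball `B = B(x₀, R)` (the tree's `HasWeakFDerivOn`), `F`
locally integrable on `B`, and `∫_B g(∇φ) = ∫_B ⟨F, ∇φ⟩` for all `φ ∈ C_c^∞(B)` — this file proves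
the **localisation identity** behind the first step of every interior estimate
(Gilbarg–Trudinger, proof of Thm. 8.17 / §8.3; Giaquinta 1983, Ch. III, proof of Thm. 2.2): for
a cut-off `χ ∈ C_c^∞(B)` and every `ψ ∈ C^∞(ℝ³)`,

  `∫_B χ w Δψ = -∑ⱼ ∫_B (χFⱼ + 2w ∂ⱼχ) ∂ⱼψ + ∫_B (-∑ⱼ Fⱼ∂ⱼχ - wΔχ) ψ`

(`integral_cutoff_mul_laplacian`), i.e. the compactly supported function `w̃ = χw` satisfies
`Δw̃ = div f' + h'` in `𝓓'(ℝ³)` with `f' = χF + 2w∇χ` and `h' = -⟨F, ∇χ⟩ - wΔχ` — a right-hand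
side **without the gradient of `w`**, which is what makes the potential-theoretic estimate of
`w̃` depend on `‖w‖` and `‖F‖` only. Proof: test the weak derivative with `χ∂ⱼψ` and with `ψ∂ⱼχ`,
the equation with `χψ`, expand by the product rule and combine (all integrands are a test
function on `B` times a locally integrable function, `SerrinBoundedHolder.integrableOn_test_mul`).
Also: the coordinate forms `g(∇φ) = ∑ⱼ ∂ⱼφ g(eⱼ)`, `⟪F, ∇φ⟫ = ∑ⱼ Fⱼ∂ⱼφ` and closure of test
functions under multiplication by smooth functions.

## References

* D. Gilbarg, N. S. Trudinger, *Elliptic Partial Differential Equations of Second Order*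
  (2001), §8.3–§8.6 (cut-off test functions `η²u`, `ηu` in the interior estimates).
  [`GilbargTrudinger2001`]
* M. Giaquinta, *Multiple Integrals in the Calculus of Variations and Nonlinear Elliptic
  Systems* (1983), Ch. III, §2 (localisation in the proof of Thm. 2.2).
-/

noncomputable section

open MeasureTheory Set Function Filter Topology TopologicalSpace Metric
open scoped NNReal ENNReal RealInnerProductSpace Laplacian

namespace Literature.Analysis.FluidPDE

/-- Local notation for physical space `ℝ³ = EuclideanSpace ℝ (Fin 3)`. -/
local notation "ℝ³" => EuclideanSpace ℝ (Fin 3)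

/-- Local notation for the standard basis vectors of `ℝ³`. -/
local notation "𝐞" j => EuclideanSpace.single (j : Fin 3) (1 : ℝ)

namespace LaplaceDivFormLocalisation

open SerrinBoundedHolder

variable {x₀ : ℝ³} {R : ℝ} {w : ℝ³ → ℝ} {g : ℝ³ → ℝ³ →L[ℝ] ℝ} {F : ℝ³ → ℝ³}

/-- A dual vector applied to the gradient, in coordinates: `g(∇φ) = ∑ⱼ ∂ⱼφ · g(eⱼ)`. [folklore] -/
theorem dual_apply_gradient (ℓ : ℝ³ →L[ℝ] ℝ) (φ : ℝ³ → ℝ) (x : ℝ³) :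
    ℓ (gradient φ x) = ∑ j, fderiv ℝ φ x (𝐞 j) * ℓ (𝐞 j) := by
  conv_lhs => rw [eq_sum_coord_smul_single (gradient φ x)]
  simp [map_sum, map_smul, gradient_coord]

/-- `⟪F, ∇φ⟫ = ∑ⱼ Fⱼ ∂ⱼφ`. [folklore] -/
theorem inner_gradient_eq_sum (F : ℝ³) (φ : ℝ³ → ℝ) (x : ℝ³) :
    ⟪F, gradient φ x⟫ = ∑ j, F j * fderiv ℝ φ x (𝐞 j) := by
  conv_lhs => rw [eq_sum_coord_smul_single F]
  rw [inner_sum_smul_single]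
  simp [gradient_coord]

/-- A test function times a smooth function is a test function on the same set. [folklore] -/
theorem isTestFunctionOn_mul_right {U : Opens ℝ³} {a b : ℝ³ → ℝ}
    (ha : FunctionSpaces.IsTestFunctionOn U a) (hb : ContDiff ℝ (⊤ : ℕ∞) b) :
    FunctionSpaces.IsTestFunctionOn U fun x => a x * b x where
  contDiff := ha.contDiff.mul hb
  hasCompactSupport := ha.hasCompactSupport.mul_right
  tsupport_subset := (tsupport_mul_subset_left (f := a) (g := b)).trans ha.tsupport_subset

/-- A smooth function times a test function is a test function on the same set. [folklore] -/
theorem isTestFunctionOn_mul_left {U : Opens ℝ³} {a b : ℝ³ → ℝ}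
    (ha : ContDiff ℝ (⊤ : ℕ∞) a) (hb : FunctionSpaces.IsTestFunctionOn U b) :
    FunctionSpaces.IsTestFunctionOn U fun x => a x * b x where
  contDiff := ha.mul hb.contDiff
  hasCompactSupport := hb.hasCompactSupport.mul_left
  tsupport_subset := (tsupport_mul_subset_right (f := a) (g := b)).trans hb.tsupport_subset

/-- **The localisation identity.** Let `w` have weak derivative `g` on `B = B(x₀, R)`, `F` be
locally integrable on `B`, and `∫_B g(∇φ) = ∫_B ⟨F, ∇φ⟩` for all `φ ∈ C_c^∞(B)` (weak form of
`Δw = div F`). For a cut-off `χ ∈ C_c^∞(B)` and every `ψ ∈ C_c^∞(ℝ³)`,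
`∫ χw Δψ = -∑ⱼ ∫ (χFⱼ + 2w∂ⱼχ) ∂ⱼψ + ∫ (-∑ⱼ Fⱼ∂ⱼχ - wΔχ) ψ`, i.e. in `𝓓'(ℝ³)`
`Δ(χw) = div(χF + 2w∇χ) - ⟨F, ∇χ⟩ - wΔχ` (test the weak derivative with `χ∂ⱼψ` and `ψ∂ⱼχ`,
the equation with `χψ`). [folklore] -/
theorem integral_cutoff_mul_laplacian
    (hw : FunctionSpaces.HasWeakFDerivOn (⟨ball x₀ R, isOpen_ball⟩ : Opens ℝ³) volume w g)
    (hF : LocallyIntegrableOn F (ball x₀ R) volume)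
    (heq : ∀ φ : ℝ³ → ℝ, FunctionSpaces.IsTestFunctionOn (⟨ball x₀ R, isOpen_ball⟩ : Opens ℝ³) φ →
      ∫ x in ball x₀ R, g x (gradient φ x) = ∫ x in ball x₀ R, ⟪F x, gradient φ x⟫)
    {χ : ℝ³ → ℝ} (hχ : ContDiff ℝ (⊤ : ℕ∞) χ) (hχc : HasCompactSupport χ)
    (hχs : tsupport χ ⊆ ball x₀ R)
    {ψ : ℝ³ → ℝ} (hψ : ContDiff ℝ (⊤ : ℕ∞) ψ) :
    ∫ x in ball x₀ R, χ x * w x * (Δ ψ) x =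
      -(∑ j, ∫ x in ball x₀ R, (χ x * F x j + 2 * w x * fderiv ℝ χ x (𝐞 j)) *
          fderiv ℝ ψ x (𝐞 j)) +
        ∫ x in ball x₀ R, (-(∑ j, F x j * fderiv ℝ χ x (𝐞 j)) - w x * (Δ χ) x) * ψ x := by
  set U : Opens ℝ³ := ⟨ball x₀ R, isOpen_ball⟩ with hU
  have hχT : FunctionSpaces.IsTestFunctionOn U χ := ⟨hχ, hχc, hχs⟩
  have hdχT : ∀ j : Fin 3, FunctionSpaces.IsTestFunctionOn U fun x => fderiv ℝ χ x (𝐞 j) :=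
    fun j => isTestFunctionOn_fderiv_apply hχT (𝐞 j)
  -- smoothness of the derivatives
  have hdψ : ∀ j : Fin 3, ContDiff ℝ (⊤ : ℕ∞) fun x => fderiv ℝ ψ x (𝐞 j) := fun j =>
    (hψ.fderiv_right (m := (⊤ : ℕ∞)) le_rfl).clm_apply contDiff_const
  have hddψ : ∀ j : Fin 3, ContDiff ℝ (⊤ : ℕ∞)
      fun x => fderiv ℝ (fun y => fderiv ℝ ψ y (𝐞 j)) x (𝐞 j) := fun j =>
    ((hdψ j).fderiv_right (m := (⊤ : ℕ∞)) le_rfl).clm_apply contDiff_const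
  have hddχT : ∀ j : Fin 3, FunctionSpaces.IsTestFunctionOn U
      fun x => fderiv ℝ (fun y => fderiv ℝ χ y (𝐞 j)) x (𝐞 j) := fun j =>
    isTestFunctionOn_fderiv_apply (hdχT j) (𝐞 j)
  -- the test functions used
  have hT1 : ∀ j : Fin 3, FunctionSpaces.IsTestFunctionOn U
      fun x => χ x * fderiv ℝ ψ x (𝐞 j) := fun j => isTestFunctionOn_mul_right hχT (hdψ j)
  have hT2 : FunctionSpaces.IsTestFunctionOn U fun x => χ x * ψ x :=
    isTestFunctionOn_mul_right hχT hψ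
  have hT3 : ∀ j : Fin 3, FunctionSpaces.IsTestFunctionOn U
      fun x => ψ x * fderiv ℝ χ x (𝐞 j) := fun j => isTestFunctionOn_mul_left hψ (hdχT j)
  -- local integrability of the components
  have hwL : LocallyIntegrableOn w (ball x₀ R) volume := hw.locallyIntegrableOn
  have hgL : ∀ j : Fin 3, LocallyIntegrableOn (fun x => g x (𝐞 j)) (ball x₀ R) volume := fun j =>
    (ContinuousLinearMap.apply ℝ ℝ (𝐞 j)).locallyIntegrableOn_comp hw.locallyIntegrableOn_deriv
  have hFL : ∀ j : Fin 3, LocallyIntegrableOn (fun x => F x j) (ball x₀ R) volume := fun j =>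
    (EuclideanSpace.proj j : ℝ³ →L[ℝ] ℝ).locallyIntegrableOn_comp hF
  -- generic integrability: (test function) * (locally integrable)
  have hI : ∀ {a G : ℝ³ → ℝ}, FunctionSpaces.IsTestFunctionOn U a →
      LocallyIntegrableOn G (ball x₀ R) volume →
      IntegrableOn (fun x => a x * G x) (ball x₀ R) volume :=
    fun ha hG => integrableOn_test_mul (U := U) ha.contDiff.continuous ha.hasCompactSupport
      ha.tsupport_subset hG
  -- the basic integrals
  set A : Fin 3 → ℝ := fun j => ∫ x in ball x₀ R, (ψ x * fderiv ℝ χ x (𝐞 j)) * F x j with hA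
  set B : Fin 3 → ℝ := fun j => ∫ x in ball x₀ R, (χ x * fderiv ℝ ψ x (𝐞 j)) * F x j with hB
  set C : Fin 3 → ℝ := fun j =>
    ∫ x in ball x₀ R, (fderiv ℝ ψ x (𝐞 j) * fderiv ℝ χ x (𝐞 j)) * w x with hC
  set D : Fin 3 → ℝ := fun j =>
    ∫ x in ball x₀ R, (ψ x * fderiv ℝ (fun y => fderiv ℝ χ y (𝐞 j)) x (𝐞 j)) * w x with hD
  set Gi : Fin 3 → ℝ := fun j => ∫ x in ball x₀ R, (χ x * fderiv ℝ ψ x (𝐞 j)) * g x (𝐞 j)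
    with hGi
  set Hi : Fin 3 → ℝ := fun j => ∫ x in ball x₀ R, (ψ x * fderiv ℝ χ x (𝐞 j)) * g x (𝐞 j)
    with hHi
  set L : Fin 3 → ℝ := fun j =>
    ∫ x in ball x₀ R, (χ x * fderiv ℝ (fun y => fderiv ℝ ψ y (𝐞 j)) x (𝐞 j)) * w x with hL
  -- integrability of the basic integrands
  have hIA : ∀ j, IntegrableOn (fun x => (ψ x * fderiv ℝ χ x (𝐞 j)) * F x j) (ball x₀ R) volume :=
    fun j => hI (hT3 j) (hFL j)
  have hIB : ∀ j, IntegrableOn (fun x => (χ x * fderiv ℝ ψ x (𝐞 j)) * F x j) (ball x₀ R) volume :=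
    fun j => hI (hT1 j) (hFL j)
  have hIC : ∀ j, IntegrableOn (fun x => (fderiv ℝ ψ x (𝐞 j) * fderiv ℝ χ x (𝐞 j)) * w x)
      (ball x₀ R) volume := fun j => hI (isTestFunctionOn_mul_left (hdψ j) (hdχT j)) hwL
  have hID : ∀ j, IntegrableOn
      (fun x => (ψ x * fderiv ℝ (fun y => fderiv ℝ χ y (𝐞 j)) x (𝐞 j)) * w x)
      (ball x₀ R) volume := fun j => hI (isTestFunctionOn_mul_left hψ (hddχT j)) hwL
  have hIG : ∀ j, IntegrableOn (fun x => (χ x * fderiv ℝ ψ x (𝐞 j)) * g x (𝐞 j)) (ball x₀ R)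
      volume := fun j => hI (hT1 j) (hgL j)
  have hIH : ∀ j, IntegrableOn (fun x => (ψ x * fderiv ℝ χ x (𝐞 j)) * g x (𝐞 j)) (ball x₀ R)
      volume := fun j => hI (hT3 j) (hgL j)
  have hIL : ∀ j, IntegrableOn
      (fun x => (χ x * fderiv ℝ (fun y => fderiv ℝ ψ y (𝐞 j)) x (𝐞 j)) * w x)
      (ball x₀ R) volume := fun j => hI (isTestFunctionOn_mul_right hχT (hddψ j)) hwL
  -- product rules
  have hp1 : ∀ x (j : Fin 3), fderiv ℝ (fun x => χ x * fderiv ℝ ψ x (𝐞 j)) x (𝐞 j) =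
      χ x * fderiv ℝ (fun y => fderiv ℝ ψ y (𝐞 j)) x (𝐞 j) +
        fderiv ℝ ψ x (𝐞 j) * fderiv ℝ χ x (𝐞 j) := by
    intro x j
    rw [fderiv_fun_mul (hχ.differentiable (by simp) x) ((hdψ j).differentiable (by simp) x)]
    simp only [add_apply, FunLike.coe_smul, Pi.smul_apply, smul_eq_mul]
  have hp2 : ∀ x (j : Fin 3), fderiv ℝ (fun x => ψ x * fderiv ℝ χ x (𝐞 j)) x (𝐞 j) =
      ψ x * fderiv ℝ (fun y => fderiv ℝ χ y (𝐞 j)) x (𝐞 j) +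
        fderiv ℝ χ x (𝐞 j) * fderiv ℝ ψ x (𝐞 j) := by
    intro x j
    rw [fderiv_fun_mul (hψ.differentiable (by simp) x)
      ((hdχT j).contDiff.differentiable (by simp) x)]
    simp only [add_apply, FunLike.coe_smul, Pi.smul_apply, smul_eq_mul]
  have hp3 : ∀ x (j : Fin 3), fderiv ℝ (fun x => χ x * ψ x) x (𝐞 j) =
      χ x * fderiv ℝ ψ x (𝐞 j) + ψ x * fderiv ℝ χ x (𝐞 j) := by
    intro x j
    rw [fderiv_fun_mul (hχ.differentiable (by simp) x) (hψ.differentiable (by simp) x)]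
    simp only [add_apply, FunLike.coe_smul, Pi.smul_apply, smul_eq_mul]
  -- (W1) weak derivative tested with `χ ∂ⱼψ`:  `L j + C j = -Gi j`
  have hW1 : ∀ j, L j + C j = -Gi j := by
    intro j
    have h := hw.integral_fderiv_smul_eq _ (𝐞 j) (hT1 j)
    have h' : ∫ x in ball x₀ R, fderiv ℝ (fun x => χ x * fderiv ℝ ψ x (𝐞 j)) x (𝐞 j) • w x =
        -∫ x in ball x₀ R, (χ x * fderiv ℝ ψ x (𝐞 j)) • g x (𝐞 j) := h
    have e1 : ∫ x in ball x₀ R, fderiv ℝ (fun x => χ x * fderiv ℝ ψ x (𝐞 j)) x (𝐞 j) • w x =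
        L j + C j := by
      rw [hL, hC, ← integral_add (hIL j) (hIC j)]
      refine integral_congr_ae (Eventually.of_forall fun x => ?_)
      simp only [hp1, smul_eq_mul]
      ring
    have e2 : ∫ x in ball x₀ R, (χ x * fderiv ℝ ψ x (𝐞 j)) • g x (𝐞 j) = Gi j := by
      simp only [smul_eq_mul, hGi]
    rw [e1, e2] at h'
    exact h'
  -- (W2) weak derivative tested with `ψ ∂ⱼχ`:  `D j + C j = -Hi j`
  have hW2 : ∀ j, D j + C j = -Hi j := by
    intro j
    have h := hw.integral_fderiv_smul_eq _ (𝐞 j) (hT3 j)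
    have h' : ∫ x in ball x₀ R, fderiv ℝ (fun x => ψ x * fderiv ℝ χ x (𝐞 j)) x (𝐞 j) • w x =
        -∫ x in ball x₀ R, (ψ x * fderiv ℝ χ x (𝐞 j)) • g x (𝐞 j) := h
    have e1 : ∫ x in ball x₀ R, fderiv ℝ (fun x => ψ x * fderiv ℝ χ x (𝐞 j)) x (𝐞 j) • w x =
        D j + C j := by
      rw [hD, hC, ← integral_add (hID j) (hIC j)]
      refine integral_congr_ae (Eventually.of_forall fun x => ?_)
      simp only [hp2, smul_eq_mul]
      ring
    have e2 : ∫ x in ball x₀ R, (ψ x * fderiv ℝ χ x (𝐞 j)) • g x (𝐞 j) = Hi j := by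
      simp only [smul_eq_mul, hHi]
    rw [e1, e2] at h'
    exact h'
  -- (E) the equation tested with `χψ`:  `∑ (Gi + Hi) = ∑ (B + A)`
  have hE : ∑ j, (Gi j + Hi j) = ∑ j, (B j + A j) := by
    have h := heq _ hT2
    simp_rw [dual_apply_gradient, inner_gradient_eq_sum] at h
    have hl : ∀ j : Fin 3, IntegrableOn
        (fun x => fderiv ℝ (fun x => χ x * ψ x) x (𝐞 j) * g x (𝐞 j)) (ball x₀ R) volume := by
      intro j
      refine ((hIG j).add (hIH j)).congr_fun (fun x _ => ?_) measurableSet_ball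
      simp only [hp3, Pi.add_apply]
      ring
    have hr : ∀ j : Fin 3, IntegrableOn
        (fun x => F x j * fderiv ℝ (fun x => χ x * ψ x) x (𝐞 j)) (ball x₀ R) volume := by
      intro j
      refine ((hIB j).add (hIA j)).congr_fun (fun x _ => ?_) measurableSet_ball
      simp only [hp3, Pi.add_apply]
      ring
    rw [integral_finsetSum _ fun j _ => hl j, integral_finsetSum _ fun j _ => hr j] at h
    have hl' : ∀ j, ∫ x in ball x₀ R, fderiv ℝ (fun x => χ x * ψ x) x (𝐞 j) * g x (𝐞 j) =
        Gi j + Hi j := by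
      intro j
      rw [hGi, hHi, ← integral_add (hIG j) (hIH j)]
      refine integral_congr_ae (Eventually.of_forall fun x => ?_)
      simp only [hp3]
      ring
    have hr' : ∀ j, ∫ x in ball x₀ R, F x j * fderiv ℝ (fun x => χ x * ψ x) x (𝐞 j) =
        B j + A j := by
      intro j
      rw [hB, hA, ← integral_add (hIB j) (hIA j)]
      refine integral_congr_ae (Eventually.of_forall fun x => ?_)
      simp only [hp3]
      ring
    simp_rw [hl', hr'] at h
    exact h
  -- the left-hand side: `∫ χ w Δψ = ∑ L`
  have hLHS : ∫ x in ball x₀ R, χ x * w x * (Δ ψ) x = ∑ j, L j := by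
    have hψ2 : ContDiff ℝ 2 ψ := hψ.of_le (by norm_cast)
    have hΔ : ∀ x, (Δ ψ) x = ∑ j, fderiv ℝ (fun y => fderiv ℝ ψ y (𝐞 j)) x (𝐞 j) := by
      intro x
      simp only [laplacian_eq_sum_fderiv_fderiv (EuclideanSpace.basisFun (Fin 3) ℝ) hψ2,
        EuclideanSpace.basisFun_apply]
    have hIL' : ∀ j, IntegrableOn
        (fun x => χ x * w x * fderiv ℝ (fun y => fderiv ℝ ψ y (𝐞 j)) x (𝐞 j)) (ball x₀ R)
        volume := fun j =>
      (hIL j).congr_fun (fun x _ => by ring) measurableSet_ball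
    simp_rw [hΔ, Finset.mul_sum]
    rw [integral_finsetSum _ fun j _ => hIL' j]
    refine Finset.sum_congr rfl fun j _ => ?_
    rw [hL]
    refine integral_congr_ae (Eventually.of_forall fun x => ?_)
    ring
  -- the right-hand side
  have hR1 : ∀ j, ∫ x in ball x₀ R, (χ x * F x j + 2 * w x * fderiv ℝ χ x (𝐞 j)) *
      fderiv ℝ ψ x (𝐞 j) = B j + 2 * C j := by
    intro j
    rw [hB, hC, ← integral_const_mul, ← integral_add (hIB j) ((hIC j).const_mul 2)]
    refine integral_congr_ae (Eventually.of_forall fun x => ?_)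
    ring
  have hR2 : ∫ x in ball x₀ R, (-(∑ j, F x j * fderiv ℝ χ x (𝐞 j)) - w x * (Δ χ) x) * ψ x =
      -(∑ j, A j) - ∑ j, D j := by
    have hχ2 : ContDiff ℝ 2 χ := hχ.of_le (by norm_cast)
    have hΔ : ∀ x, (Δ χ) x = ∑ j, fderiv ℝ (fun y => fderiv ℝ χ y (𝐞 j)) x (𝐞 j) := by
      intro x
      simp only [laplacian_eq_sum_fderiv_fderiv (EuclideanSpace.basisFun (Fin 3) ℝ) hχ2,
        EuclideanSpace.basisFun_apply]
    have e : ∀ x, (-(∑ j, F x j * fderiv ℝ χ x (𝐞 j)) - w x * (Δ χ) x) * ψ x =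
        -(∑ j, ((ψ x * fderiv ℝ χ x (𝐞 j)) * F x j +
          (ψ x * fderiv ℝ (fun y => fderiv ℝ χ y (𝐞 j)) x (𝐞 j)) * w x)) := by
      intro x
      simp only [hΔ, Fin.sum_univ_three]
      ring
    have hIAD : ∀ j, IntegrableOn (fun x => (ψ x * fderiv ℝ χ x (𝐞 j)) * F x j +
        (ψ x * fderiv ℝ (fun y => fderiv ℝ χ y (𝐞 j)) x (𝐞 j)) * w x) (ball x₀ R) volume :=
      fun j => (hIA j).add (hID j)
    simp_rw [e]
    rw [integral_neg, integral_finsetSum _ fun j _ => hIAD j,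
      Finset.sum_congr rfl fun j _ => integral_add (hIA j) (hID j), Finset.sum_add_distrib]
    simp only [hA, hD]
    ring
  -- combine
  rw [hLHS, Finset.sum_congr rfl fun j _ => hR1 j, hR2]
  simp only [Fin.sum_univ_three] at hE ⊢
  linarith [hW1 0, hW1 1, hW1 2, hW2 0, hW2 1, hW2 2]

end LaplaceDivFormLocalisation

end Literature.Analysis.FluidPDE
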